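import Literature.NumberTheory.Automorphic.ResGLnCuspidalCohomologyApexBasic
import Literature.NumberTheory.Automorphic.GKSubquotient
import Literature.Algebra.Lie.ChevalleyEilenbergInjectiveMap
import HarnessLib

/-!
# Clozel's cocycle (apex fact (a′)): level-fixed classes from a `(𝔤, K_∞)`-submodule of `W`

Topic `NumberTheory/Automorphic`; namespace `Literature.NumberTheory.Automorphic.ConeDictionary` (the
vocabulary of `ResGLnConeDictionary` / `ResGLnCuspidalCohomologyApex{,Level,Basic}`: the complex
`gkComplexLS π S λ = C^•(𝔤, K_∞; W ⊗ (E_λ(ℂ) ⊗ ε_S))`, level-fixed cochains `IsLevelFixed π λ 𝔫`, the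
retraction `e_{K(𝔫)} = levelProj`).  Definitions with bodies and theorems; no named fact, no `sorry`
(D-0026: a brick of the proof of the apex fact `ConeDictionary.Clozel1990_exists_basic_levelFixed_cocycle`).

After `…ApexLevel` (the basic cocycle need only be a non-coboundary of the LEVEL-FIXED subcomplex) and
`…ApexBasic` (the basic condition can be dropped in degrees `≥ 2`), the apex fact is reduced to producing a
level-fixed cocycle of degree `q + 2` of `gkComplexLS π S λ` which is not the coboundary of a level-fixed
cochain.  In print such classes come from the `(𝔤, K_∞)`-module of `K(𝔫)`-INVARIANTS
`W^{K(𝔫)} ≅ π_∞ ⊗ π_f^{K(𝔫)}` [cite: Clozel1990, §3.5 (p. 123)] and a non-zero class of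
`H^•(𝔤, K_∞; π_∞ ⊗ E_λ ⊗ ε_S)` [cite: Clozel1990, Lemme 3.14].  THIS FILE provides the passage from an
abstract `(𝔤, K_∞)`-module `V` mapping isomorphically onto `W^{K(𝔫)} = e_{K(𝔫)} W` to level-fixed classes:

* `gkComplexV ρK ρ𝔤 had S λ` — the `(𝔤, K_∞)`-complex `C^•(𝔤, K_∞; V ⊗ (E_λ(ℂ) ⊗ ε_S))` of a
  `(𝔤, K_∞)`-module `(V, ρK, ρ𝔤)` (the tree's `gkComplex` of the tensor pair); `moduleHom` — the cochain
  map `(j ⊗ 1)_*` of an intertwiner `j : V → W` [cite: BorelWallach2000, I §5.1];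
* `exists_levelFixed_of_moduleHom` — **if `j` is injective with image `e_{K(𝔫)} W` (`e ∘ j = j` and
  `e w = w ⇒ w ∈ j(V)`), every cocycle `z` of `C^{q+1}(𝔤, K_∞; V ⊗ (E_λ ⊗ ε_S))` which is not a coboundary
  gives the level-fixed cocycle `(j ⊗ 1)_* z` of `gkComplexLS π S λ` which is not the coboundary of a
  level-fixed cochain** (level-fixed cochains take values in `e(W) ⊗ E = (j ⊗ 1)(V ⊗ E)`, and `(j ⊗ 1)_*`
  is injective and reflects the complex: `ChevalleyEilenbergInjectiveMap`);
* `invW π h𝔫 = e_{K(𝔫)} W` — **the `(𝔤, K_∞)`-module of `K(𝔫)`-invariants** `W^{K(𝔫)}` (a `ℂ`-subspace of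
  `W` stable under `K_∞` and `𝔤`: `e_{K(𝔫)}` commutes with both), with the restricted actions `invKRep`,
  `invLie` (`GKSubquotient`) and their compatibility `inv_ad_compat`; its inclusion satisfies the hypotheses
  above (`subtype_comp_invKRep`, `subtype_comp_invLie`, `levelProj_coe_invW`, `mem_range_subtype_of_levelProj_eq`);
* `exists_levelFixed_of_retraction`, `Clozel1990_exists_basic_levelFixed_cocycle_of_retractClass` — the same
  for a `(𝔤, K_∞)`-RETRACT `V` of `W` inside `e_{K(𝔫)} W` (`r ∘ j = id`; no injectivity-onto-image needed, and
  `(j ⊗ 1)_* z` is then not a coboundary at all): the form in which one copy of `π_∞ ⊆ W^{K(𝔫)}` is used;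
* `Clozel1990_exists_basic_levelFixed_cocycle_of_moduleClass`,
  `Clozel1990_exists_basic_levelFixed_cocycle_of_invariantsClass`,
  `Clozel1990_exists_basic_levelFixed_cocycle_of_gkCohomology_ne_zero` — hence **the apex fact follows from: for
  every `n ≥ 2`, `𝔫 ≠ 0`, dominant `λ` and clean cohomological cuspidal `π` with a `K(𝔫)`-fixed vector there
  are a set `S` of real places and a cocycle of some degree `q + 2` of
  `C^•(𝔤, K_∞; W^{K(𝔫)} ⊗ (E_λ(ℂ) ⊗ ε_S))` which is not a coboundary** (or the same for any `(𝔤, K_∞)`-module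
  `V` with an injective intertwiner onto `e_{K(𝔫)} W`) — i.e. `H^{q+2}(𝔤, K_∞; W^{K(𝔫)} ⊗ E_λ ⊗ ε_S) ≠ 0`,
  the statement delivered by Clozel's Lemme 3.14 with the decomposition `W^{K(𝔫)} ≅ π_∞ ⊗ π_f^{K(𝔫)}`
  [cite: Clozel1990, Lemme 3.14 (p. 114), §3.5 (pp. 120–123)].

## References

* A. Borel, N. Wallach, *Continuous cohomology, discrete subgroups, and representations of reductive
  groups*, 2nd ed. (2000), I §5.1. [BorelWallach2000]
* L. Clozel, *Motifs et formes automorphes: applications du principe de fonctorialité*, Perspect. Math. 10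
  (1990), Lemme 3.14 (p. 114), §3.5 (pp. 120–123). [Clozel1990]
-/

noncomputable section

open scoped Classical TensorProduct Matrix
open NumberField IsDedekindDomain NumberField.InfinitePlace NumberField.mixedEmbedding

namespace Literature.NumberTheory.Automorphic

-- Mathlib idiom (as in `GKModules` and the whole cone dictionary): commutator bracket on matrix algebras
attribute [local instance 100] LieRing.ofAssociativeRing

namespace ConeDictionary

open ResGLnCohomology BigHeckeGLn RealMatrixGroup Literature.Algebra.Lie.ChevalleyEilenberg

variable {n : ℕ} {K : Type} [Field K] [NumberField K] {hcpt : isCompact_glFiniteIntegralLevel n K}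
  (π : AutomorphicRepData (AutomorphyDatum.gl n K hcpt))
  {V : Type} [AddCommGroup V] [Module ℂ V]
  (ρK : Representation ℂ (AutomorphyDatum.gl n K hcpt).arch.maximalCompact V)
  (ρ𝔤 : (AutomorphyDatum.gl n K hcpt).arch.lie →ₗ⁅ℝ⁆ Module.End ℂ V)
  (had : ∀ (k : (AutomorphyDatum.gl n K hcpt).arch.maximalCompact) (X : (AutomorphyDatum.gl n K hcpt).arch.lie),
    ρK k ∘ₗ ρ𝔤 X ∘ₗ ρK k⁻¹ =
      ρ𝔤 ((AutomorphyDatum.gl n K hcpt).arch.Ad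
        (Subgroup.inclusion (AutomorphyDatum.gl n K hcpt).arch.maximalCompact_le_carrier k) X))
  (S : Finset {w : InfinitePlace K // w.IsReal}) (lam : (K →+* ℂ) → Fin n → ℤ)

/-! ### The complex of `V ⊗ (E_λ ⊗ ε_S)` for a `(𝔤, K_∞)`-module `V` -/

section ModuleComplex

/-- The value module `V ⊗_ℂ (E_λ(ℂ) ⊗ ε_S)` with the Leibniz `𝔤`-action. [cite: BorelWallach2000, I §5.1] -/
abbrev CarrierV : Type :=
  GKCarrier (AutomorphyDatum.gl n K hcpt).arch
    (GKTensor.lie (AutomorphyDatum.gl n K hcpt).arch ρ𝔤 (σ𝔤S hcpt lam))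

/-- **The `(𝔤, K_∞)`-complex `C^•(𝔤, K_∞; V ⊗ (E_λ(ℂ) ⊗ ε_S))`** of a `(𝔤, K_∞)`-module `(V, ρK, ρ𝔤)`.
[cite: BorelWallach2000, I §5.1 (1)–(3)] -/
abbrev gkComplexV :
    Subcomplex ℝ (AutomorphyDatum.gl n K hcpt).arch.lie (CarrierV ρ𝔤 lam) :=
  gkComplex (AutomorphyDatum.gl n K hcpt).arch (ρK.tprod (σSK hcpt S lam))
    (GKTensor.lie (AutomorphyDatum.gl n K hcpt).arch ρ𝔤 (σ𝔤S hcpt lam))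
    (GKTensor.ad_compat (AutomorphyDatum.gl n K hcpt).arch ρK ρ𝔤 (σSK hcpt S lam) (σ𝔤S hcpt lam) had
      (σS_ad_compat S lam))

/-- The pair action of the complex of `V ⊗ (E_λ ⊗ ε_S)`. [cite: BorelWallach2000, I §5.1 (1)] -/
abbrev pairActionV :
    PairAction ℝ (AutomorphyDatum.gl n K hcpt).arch.lie (CarrierV ρ𝔤 lam) (AutomorphyDatum.gl n K hcpt).arch.maximalCompact :=
  gkPairAction (AutomorphyDatum.gl n K hcpt).arch (ρK.tprod (σSK hcpt S lam))
    (GKTensor.lie (AutomorphyDatum.gl n K hcpt).arch ρ𝔤 (σ𝔤S hcpt lam))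
    (GKTensor.ad_compat (AutomorphyDatum.gl n K hcpt).arch ρK ρ𝔤 (σSK hcpt S lam) (σ𝔤S hcpt lam) had
      (σS_ad_compat S lam))

/-- `gkComplexV` in the generic form `C^•(𝔤, 𝔨; ·)^{K_∞}` (definitional). [folklore] -/
theorem gkComplexV_eq_gK :
    gkComplexV ρK ρ𝔤 had S lam = Subcomplex.gK ℝ (AutomorphyDatum.gl n K hcpt).arch.lie (CarrierV ρ𝔤 lam)
      (AutomorphyDatum.gl n K hcpt).arch.kInLie (pairActionV ρK ρ𝔤 had S lam) :=
  rfl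

end ModuleComplex

/-! ### The cochain map `(j ⊗ 1)_*` of an intertwiner `j : V → W` -/

section Intertwiner

variable {ρ𝔤} (j : V →ₗ[ℂ] π.W)
  (hj𝔤 : ∀ X : (AutomorphyDatum.gl n K hcpt).arch.lie, j ∘ₗ ρ𝔤 X = π.lieRepW X ∘ₗ j)

include hj𝔤 in
/-- `j ⊗ 1` intertwines the Leibniz actions. [cite: BorelWallach2000, I §5.1] -/
theorem rTensor_comp_lieV (X : (AutomorphyDatum.gl n K hcpt).arch.lie) :
    j.rTensor (ResGLnCohomology.CoeffModule ℂ n K lam) ∘ₗ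
        GKTensor.lie (AutomorphyDatum.gl n K hcpt).arch ρ𝔤 (σ𝔤S hcpt lam) X =
      GKTensor.lie (AutomorphyDatum.gl n K hcpt).arch π.lieRepW (σ𝔤S hcpt lam) X ∘ₗ
        j.rTensor (ResGLnCohomology.CoeffModule ℂ n K lam) := by
  rw [GKTensor.lie_apply, GKTensor.lie_apply, LinearMap.comp_add, LinearMap.add_comp, ← LinearMap.rTensor_comp,
    hj𝔤 X, LinearMap.rTensor_comp, LinearMap.rTensor_comp_lTensor, LinearMap.lTensor_comp_rTensor]

/-- `j ⊗ 1` intertwines the diagonal `K_∞`-actions when `j` intertwines `ρK` and `r|_{K_∞}`.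
[cite: BorelWallach2000, I §5.1] -/
theorem rTensor_comp_tprodV
    (hjK : ∀ k : (AutomorphyDatum.gl n K hcpt).arch.maximalCompact, j ∘ₗ ρK k = π.kRepW k ∘ₗ j)
    (k : (AutomorphyDatum.gl n K hcpt).arch.maximalCompact) :
    j.rTensor (ResGLnCohomology.CoeffModule ℂ n K lam) ∘ₗ (ρK.tprod (σSK hcpt S lam)) k =
      (π.kRepW.tprod (σSK hcpt S lam)) k ∘ₗ j.rTensor (ResGLnCohomology.CoeffModule ℂ n K lam) := by
  rw [Representation.tprod_apply, Representation.tprod_apply, LinearMap.rTensor_comp_map,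
    LinearMap.map_comp_rTensor, hjK]

/-- **The intertwiner `j ⊗ 1 : V ⊗ E → W ⊗ E` as a morphism of `𝔤`-modules** (between the carriers of the
complexes). [cite: BorelWallach2000, I §5.1] -/
def moduleHom : CarrierV ρ𝔤 lam →ₗ⁅ℝ,(AutomorphyDatum.gl n K hcpt).arch.lie⁆ Carrier π lam :=
  GKCarrier.hom (AutomorphyDatum.gl n K hcpt).arch
    (GKTensor.lie (AutomorphyDatum.gl n K hcpt).arch ρ𝔤 (σ𝔤S hcpt lam))
    (GKTensor.lie (AutomorphyDatum.gl n K hcpt).arch π.lieRepW (σ𝔤S hcpt lam))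
    (j.rTensor (ResGLnCohomology.CoeffModule ℂ n K lam)) (rTensor_comp_lieV π lam j hj𝔤)

/-- Unfolding: `moduleHom` is `j ⊗ 1` on elements. [folklore] -/
theorem moduleHom_apply (t : CarrierV ρ𝔤 lam) :
    @id (π.W ⊗[ℂ] ResGLnCohomology.CoeffModule ℂ n K lam) (moduleHom π lam j hj𝔤 t) =
      j.rTensor (ResGLnCohomology.CoeffModule ℂ n K lam) (@id (V ⊗[ℂ] ResGLnCohomology.CoeffModule ℂ n K lam) t) :=
  rfl

/-- `(j ⊗ 1)` is injective for injective `j` (`E_λ ⊗ ε_S` is a flat — indeed free — `ℂ`-module). [folklore] -/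
theorem moduleHom_injective (hj : Function.Injective j) : Function.Injective (moduleHom π lam j hj𝔤) :=
  Module.Flat.rTensor_preserves_injective_linearMap (M := ResGLnCohomology.CoeffModule ℂ n K lam) j hj

end Intertwiner

/-! ### Level-fixed classes from classes of `V ⊗ (E_λ ⊗ ε_S)` -/

section Classes

variable {ρK ρ𝔤} {𝔫 : Ideal (𝓞 K)} (h𝔫 : 𝔫 ≠ 0) {j : V →ₗ[ℂ] π.W}

/-- `r(u) ∘ j = j` for `u ∈ K_f(𝔫)` when `j` takes values in `e_{K(𝔫)} W`. [cite: BernsteinZelevinsky1976, §2.3] -/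
theorem finiteRepW_comp_eq_of_levelProj (hje : ∀ v : V, levelProj π h𝔫 (j v) = j v)
    {u : (AutomorphyDatum.gl n K hcpt).finiteAdelic} (hu : u ∈ levelFin n K hcpt 𝔫) :
    π.finiteRepW u ∘ₗ j = j :=
  LinearMap.ext fun v => by rw [LinearMap.comp_apply, ← hje v, finiteRepW_levelProj π h𝔫 hu]

/-- Every value of `e_{K(𝔫)} ⊗ 1` lies in `(j ⊗ 1)(V ⊗ E)` when `e_{K(𝔫)} W ⊆ j(V)`. [folklore] -/
theorem exists_rTensor_eq_levelProjT (hej : ∀ w : π.W, levelProj π h𝔫 w = w → w ∈ LinearMap.range j)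
    (t : π.W ⊗[ℂ] ResGLnCohomology.CoeffModule ℂ n K lam) :
    ∃ s : V ⊗[ℂ] ResGLnCohomology.CoeffModule ℂ n K lam,
      j.rTensor (ResGLnCohomology.CoeffModule ℂ n K lam) s = levelProjT π lam h𝔫 t := by
  induction t using TensorProduct.induction_on with
  | zero => exact ⟨0, by rw [map_zero, map_zero]⟩
  | tmul φ x =>
    obtain ⟨v, hv⟩ := LinearMap.mem_range.1
      (hej (levelProj π h𝔫 φ) (levelProj_eq_self π h𝔫 fun u hu => finiteRepW_levelProj π h𝔫 hu φ))
    exact ⟨v ⊗ₜ x, by rw [LinearMap.rTensor_tmul, levelProjT_apply, LinearMap.rTensor_tmul, hv]⟩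
  | add x y hx hy =>
    obtain ⟨s, hs⟩ := hx
    obtain ⟨s', hs'⟩ := hy
    exact ⟨s + s', by rw [map_add, map_add, hs, hs']⟩

set_option maxHeartbeats 800000 in
-- the complexes are abbrev towers over the datum
/-- **Level-fixed classes from classes of `V ⊗ (E_λ ⊗ ε_S)`.**  Let `j : V → W` be an INJECTIVE
intertwiner of `(𝔤, K_∞)`-modules with image `e_{K(𝔫)} W` (`e ∘ j = j`, and `e w = w ⇒ w ∈ j(V)`).  Then for
every cocycle `z ∈ C^{q+1}(𝔤, K_∞; V ⊗ (E_λ ⊗ ε_S))` which is not a coboundary, `(j ⊗ 1)_* z` is a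
level-fixed cocycle of `gkComplexLS π S λ` which is not the coboundary of a level-fixed cochain of that complex
(level-fixed cochains take values in `e(W) ⊗ E = (j ⊗ 1)(V ⊗ E)` and `(j ⊗ 1)_*` is injective and reflects
the complex). [cite: BorelWallach2000, I §5.1] [cite: Clozel1990, §3.5 (p. 123)] -/
theorem exists_levelFixed_of_moduleHom
    (hjK : ∀ k : (AutomorphyDatum.gl n K hcpt).arch.maximalCompact, j ∘ₗ ρK k = π.kRepW k ∘ₗ j)
    (hj𝔤 : ∀ X : (AutomorphyDatum.gl n K hcpt).arch.lie, j ∘ₗ ρ𝔤 X = π.lieRepW X ∘ₗ j)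
    (hj : Function.Injective j) (hje : ∀ v : V, levelProj π h𝔫 (j v) = j v)
    (hej : ∀ w : π.W, levelProj π h𝔫 w = w → w ∈ LinearMap.range j) {q : ℕ}
    {z : Literature.Algebra.Lie.ChevalleyEilenberg.Cochain ℝ (AutomorphyDatum.gl n K hcpt).arch.lie (CarrierV ρ𝔤 lam) (q + 1)}
    (hz : z ∈ (gkComplexV ρK ρ𝔤 had S lam).cocycles (q + 1))
    (hz' : z ∉ (gkComplexV ρK ρ𝔤 had S lam).coboundaries (q + 1)) :
    ∃ η : Cochain π lam (q + 1), η ∈ (gkComplexLS π S lam).cocycles (q + 1) ∧ IsLevelFixed π lam 𝔫 η ∧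
      ∀ β ∈ (gkComplexLS π S lam).carrier q, IsLevelFixed π lam 𝔫 β →
        d ℝ (AutomorphyDatum.gl n K hcpt).arch.lie (Carrier π lam) q β ≠ η := by
  refine ⟨map (AutomorphyDatum.gl n K hcpt).arch.lie (moduleHom π lam j hj𝔤) (q + 1) z, ?_, ?_, ?_⟩
  · -- `(j ⊗ 1)_*` is a cochain map of the `(𝔤, K_∞)`-complexes
    have h := (isCochainMapTo_hom (AutomorphyDatum.gl n K hcpt).arch (ρK.tprod (σSK hcpt S lam))
      (GKTensor.lie (AutomorphyDatum.gl n K hcpt).arch ρ𝔤 (σ𝔤S hcpt lam)) (π.kRepW.tprod (σSK hcpt S lam))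
      (GKTensor.lie (AutomorphyDatum.gl n K hcpt).arch π.lieRepW (σ𝔤S hcpt lam))
      (GKTensor.ad_compat (AutomorphyDatum.gl n K hcpt).arch ρK ρ𝔤 (σSK hcpt S lam) (σ𝔤S hcpt lam) had
        (σS_ad_compat S lam))
      (GKTensor.ad_compat (AutomorphyDatum.gl n K hcpt).arch π.kRepW π.lieRepW (σSK hcpt S lam) (σ𝔤S hcpt lam)
        π.kRepW_lieRepW_ad_compat (σS_ad_compat S lam))
      (j.rTensor (ResGLnCohomology.CoeffModule ℂ n K lam)) (rTensor_comp_lieV π lam j hj𝔤)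
      (rTensor_comp_tprodV π ρK S lam j hjK)).mapsTo_cocycles (q + 1) z hz
    exact h
  · -- the values `(j ⊗ 1)(z w)` are `K(𝔫)`-fixed
    intro w u hu
    change (π.finiteRepW _).rTensor (ResGLnCohomology.CoeffModule ℂ n K lam)
        (j.rTensor (ResGLnCohomology.CoeffModule ℂ n K lam)
          (@id (V ⊗[ℂ] ResGLnCohomology.CoeffModule ℂ n K lam) (z w))) =
      j.rTensor (ResGLnCohomology.CoeffModule ℂ n K lam) (@id (V ⊗[ℂ] ResGLnCohomology.CoeffModule ℂ n K lam) (z w))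
    rw [← LinearMap.comp_apply, ← LinearMap.rTensor_comp,
      finiteRepW_comp_eq_of_levelProj π h𝔫 hje (ofFinite_mem_levelFin hu)]
  · -- not the coboundary of a level-fixed cochain: such cochains take values in `(j ⊗ 1)(V ⊗ E)`
    intro β hβ hβfix
    rw [gkComplexLS_eq_gK] at hβ
    rw [gkComplexV_eq_gK] at hz'
    have hβφ : ∀ v, β v ∈ LinearMap.range
        ((moduleHom π lam j hj𝔤 : CarrierV ρ𝔤 lam →ₗ⁅ℝ,(AutomorphyDatum.gl n K hcpt).arch.lie⁆ Carrier π lam) :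
          CarrierV ρ𝔤 lam →ₗ[ℝ] Carrier π lam) := fun v => by
      obtain ⟨s, hs⟩ := exists_rTensor_eq_levelProjT π lam h𝔫 hej
        (@id (π.W ⊗[ℂ] ResGLnCohomology.CoeffModule ℂ n K lam) (β v))
      have e1 := congrArg (fun g : Cochain π lam q => @id (π.W ⊗[ℂ] ResGLnCohomology.CoeffModule ℂ n K lam) (g v))
        (levelProjCochain_eq_self π lam h𝔫 q hβfix)
      exact LinearMap.mem_range.2 ⟨s, hs.trans e1⟩
    exact d_ne_map_of_not_mem_coboundaries (moduleHom π lam j hj𝔤) (moduleHom_injective π lam j hj𝔤 hj)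
      (AutomorphyDatum.gl n K hcpt).arch.kInLie (pairActionV ρK ρ𝔤 had S lam) (pairActionLS π S lam) (fun _ => rfl)
      (fun g m => LinearMap.congr_fun (rTensor_comp_tprodV π ρK S lam j hjK g)
        (@id (V ⊗[ℂ] ResGLnCohomology.CoeffModule ℂ n K lam) m))
      hz' hβ hβφ

end Classes

end ConeDictionary

/-! ### The apex fact from a class of the invariants module -/

namespace ConeDictionary

-- (fresh namespace block: no module variables / local instances in the elaboration context of the apex-level
-- statements)
open ResGLnCohomology Literature.Algebra.Lie.ChevalleyEilenberg

/-! ### The module of `K(𝔫)`-invariants `W^{K(𝔫)} = e_{K(𝔫)} W` -/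

section Invariants

variable {n : ℕ} {K : Type} [Field K] [NumberField K] {hcpt : isCompact_glFiniteIntegralLevel n K}
  (π : AutomorphicRepData (AutomorphyDatum.gl n K hcpt)) {𝔫 : Ideal (𝓞 K)} (h𝔫 : 𝔫 ≠ 0)

/-- **`W^{K(𝔫)} = e_{K(𝔫)} W`**, the `K(𝔫)`-invariants of `W` (the image of the retraction `levelProj`).
[cite: Clozel1990, §3.5 (p. 123)] [cite: BorelJacquet1979, 4.6] -/
def invW : Submodule ℂ π.W :=
  LinearMap.range (levelProj π h𝔫)

/-- Additive structure of `W^{K(𝔫)}` (the submodule structure, registered directly on `invW` so that instance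
search does not wander through normed / finite-type structures of the ambient function space). [folklore] -/
instance invW.instAddCommGroup : AddCommGroup (invW π h𝔫) :=
  Submodule.addCommGroup _

/-- Complex structure of `W^{K(𝔫)}` (the submodule structure). [folklore] -/
instance invW.instModule : Module ℂ (invW π h𝔫) :=
  Submodule.module _

/-- Membership: `w ∈ W^{K(𝔫)}` iff `e_{K(𝔫)} w = w`. [cite: BernsteinZelevinsky1976, §2.3] -/
theorem mem_invW_iff (w : π.W) : w ∈ invW π h𝔫 ↔ levelProj π h𝔫 w = w := by
  constructor
  · rintro ⟨φ, rfl⟩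
    exact levelProj_eq_self π h𝔫 fun u hu => finiteRepW_levelProj π h𝔫 hu φ
  · intro h
    exact ⟨w, h⟩

/-- `W^{K(𝔫)}` is `K_∞`-stable (`e_{K(𝔫)}` commutes with `K_∞`). [cite: BorelWallach2000, I §5.1] -/
theorem invW_le_comap_kRepW (k : (AutomorphyDatum.gl n K hcpt).arch.maximalCompact) :
    invW π h𝔫 ≤ (invW π h𝔫).comap (π.kRepW k) := by
  rintro w ⟨φ, rfl⟩
  exact ⟨π.kRepW k φ, levelProj_kRepW π h𝔫 k φ⟩

/-- `W^{K(𝔫)}` is `𝔤`-stable (`e_{K(𝔫)}` commutes with `𝔤`). [cite: BorelWallach2000, I §5.1] -/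
theorem invW_le_comap_lieRepW (X : (AutomorphyDatum.gl n K hcpt).arch.lie) :
    invW π h𝔫 ≤ (invW π h𝔫).comap (π.lieRepW X) := by
  rintro w ⟨φ, rfl⟩
  exact ⟨π.lieRepW X φ, levelProj_lieRepW π h𝔫 X φ⟩

/-- `K_∞` on `W^{K(𝔫)}`. [cite: BorelWallach2000, I §5.1] -/
abbrev invKRep : Representation ℂ (AutomorphyDatum.gl n K hcpt).arch.maximalCompact (invW π h𝔫) :=
  π.kRepW.subrepresentation (invW π h𝔫) (invW_le_comap_kRepW π h𝔫)

/-- `𝔤` on `W^{K(𝔫)}`. [cite: BorelWallach2000, I §5.1] -/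
abbrev invLie : (AutomorphyDatum.gl n K hcpt).arch.lie →ₗ⁅ℝ⁆ Module.End ℂ (invW π h𝔫) :=
  GKSubmodule.subLie (AutomorphyDatum.gl n K hcpt).arch π.lieRepW (invW π h𝔫) (invW_le_comap_lieRepW π h𝔫)

/-- `(𝔤, K_∞)`-compatibility of `W^{K(𝔫)}` (restricted from `W`). [cite: BorelWallach2000, 0 §2.5] -/
theorem inv_ad_compat (k : (AutomorphyDatum.gl n K hcpt).arch.maximalCompact) (X : (AutomorphyDatum.gl n K hcpt).arch.lie) :
    invKRep π h𝔫 k ∘ₗ invLie π h𝔫 X ∘ₗ invKRep π h𝔫 k⁻¹ =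
      invLie π h𝔫 ((AutomorphyDatum.gl n K hcpt).arch.Ad
        (Subgroup.inclusion (AutomorphyDatum.gl n K hcpt).arch.maximalCompact_le_carrier k) X) := by
  refine LinearMap.ext fun v => Subtype.ext ?_
  exact LinearMap.congr_fun (π.kRepW_lieRepW_ad_compat k X) (v : π.W)

/-- The inclusion intertwines `K_∞`. [folklore] -/
theorem subtype_comp_invKRep (k : (AutomorphyDatum.gl n K hcpt).arch.maximalCompact) :
    (invW π h𝔫).subtype ∘ₗ invKRep π h𝔫 k = π.kRepW k ∘ₗ (invW π h𝔫).subtype :=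
  LinearMap.ext fun _ => rfl

/-- The inclusion intertwines `𝔤`. [folklore] -/
theorem subtype_comp_invLie (X : (AutomorphyDatum.gl n K hcpt).arch.lie) :
    (invW π h𝔫).subtype ∘ₗ invLie π h𝔫 X = π.lieRepW X ∘ₗ (invW π h𝔫).subtype :=
  LinearMap.ext fun _ => rfl

/-- `e_{K(𝔫)}` is the identity on `W^{K(𝔫)}`. [cite: BernsteinZelevinsky1976, §2.3] -/
theorem levelProj_coe_invW (v : invW π h𝔫) : levelProj π h𝔫 ((invW π h𝔫).subtype v) = (invW π h𝔫).subtype v :=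
  (mem_invW_iff π h𝔫 _).1 v.2

/-- `e_{K(𝔫)} w = w` implies `w ∈ W^{K(𝔫)}` (as the range of the inclusion). [folklore] -/
theorem mem_range_subtype_of_levelProj_eq (w : π.W) (h : levelProj π h𝔫 w = w) :
    w ∈ LinearMap.range (invW π h𝔫).subtype :=
  ⟨⟨w, (mem_invW_iff π h𝔫 w).2 h⟩, rfl⟩

end Invariants

/-! ### Retractions: classes of a `(𝔤, K_∞)`-module `V` which is a RETRACT of `W` -/

section Retraction

variable {n : ℕ} {K : Type} [Field K] [NumberField K] {hcpt : isCompact_glFiniteIntegralLevel n K}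
  (π : AutomorphicRepData (AutomorphyDatum.gl n K hcpt))
  {V : Type} [AddCommGroup V] [Module ℂ V] {V' : Type} [AddCommGroup V'] [Module ℂ V']
  {ρ𝔤 : (AutomorphyDatum.gl n K hcpt).arch.lie →ₗ⁅ℝ⁆ Module.End ℂ V}
  {ρ𝔤' : (AutomorphyDatum.gl n K hcpt).arch.lie →ₗ⁅ℝ⁆ Module.End ℂ V'}
  (S : Finset {w : InfinitePlace K // w.IsReal}) (lam : (K →+* ℂ) → Fin n → ℤ)

/-- `T ⊗ 1` intertwines the Leibniz actions when `T` intertwines the actions of `𝔤`.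
[cite: BorelWallach2000, I §5.1] -/
theorem rTensor_comp_lie_of_comm (T : V →ₗ[ℂ] V')
    (hT : ∀ X : (AutomorphyDatum.gl n K hcpt).arch.lie, T ∘ₗ ρ𝔤 X = ρ𝔤' X ∘ₗ T)
    (X : (AutomorphyDatum.gl n K hcpt).arch.lie) :
    T.rTensor (ResGLnCohomology.CoeffModule ℂ n K lam) ∘ₗ
        GKTensor.lie (AutomorphyDatum.gl n K hcpt).arch ρ𝔤 (σ𝔤S hcpt lam) X =
      GKTensor.lie (AutomorphyDatum.gl n K hcpt).arch ρ𝔤' (σ𝔤S hcpt lam) X ∘ₗ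
        T.rTensor (ResGLnCohomology.CoeffModule ℂ n K lam) := by
  rw [GKTensor.lie_apply, GKTensor.lie_apply, LinearMap.comp_add, LinearMap.add_comp, ← LinearMap.rTensor_comp,
    hT X, LinearMap.rTensor_comp, LinearMap.rTensor_comp_lTensor, LinearMap.lTensor_comp_rTensor]

/-- `T ⊗ 1` intertwines the diagonal `K_∞`-actions when `T` intertwines the actions of `K_∞`.
[cite: BorelWallach2000, I §5.1] -/
theorem rTensor_comp_tprod_of_comm
    {ρK : Representation ℂ (AutomorphyDatum.gl n K hcpt).arch.maximalCompact V}
    {ρK' : Representation ℂ (AutomorphyDatum.gl n K hcpt).arch.maximalCompact V'} (T : V →ₗ[ℂ] V')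
    (hT : ∀ k : (AutomorphyDatum.gl n K hcpt).arch.maximalCompact, T ∘ₗ ρK k = ρK' k ∘ₗ T)
    (k : (AutomorphyDatum.gl n K hcpt).arch.maximalCompact) :
    T.rTensor (ResGLnCohomology.CoeffModule ℂ n K lam) ∘ₗ (ρK.tprod (σSK hcpt S lam)) k =
      (ρK'.tprod (σSK hcpt S lam)) k ∘ₗ T.rTensor (ResGLnCohomology.CoeffModule ℂ n K lam) := by
  rw [Representation.tprod_apply, Representation.tprod_apply, LinearMap.rTensor_comp_map,
    LinearMap.map_comp_rTensor, hT]

variable {ρK : Representation ℂ (AutomorphyDatum.gl n K hcpt).arch.maximalCompact V}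
  {had : ∀ (k : (AutomorphyDatum.gl n K hcpt).arch.maximalCompact) (X : (AutomorphyDatum.gl n K hcpt).arch.lie),
    ρK k ∘ₗ ρ𝔤 X ∘ₗ ρK k⁻¹ =
      ρ𝔤 ((AutomorphyDatum.gl n K hcpt).arch.Ad
        (Subgroup.inclusion (AutomorphyDatum.gl n K hcpt).arch.maximalCompact_le_carrier k) X)}
  {𝔫 : Ideal (𝓞 K)} (h𝔫 : 𝔫 ≠ 0) {j : V →ₗ[ℂ] π.W} {r : π.W →ₗ[ℂ] V}

set_option maxHeartbeats 800000 in
-- the complexes are abbrev towers over the datum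
/-- **Level-fixed classes from a `(𝔤, K_∞)`-retract of `W` inside `e_{K(𝔫)} W`.**  Let `j : V → W` and
`r : W → V` be intertwiners of `(𝔤, K_∞)`-modules with `r ∘ j = id` and `j(V) ⊆ e_{K(𝔫)} W` (in print:
`V = π_∞ ⊗ v` a copy of the archimedean component inside the semisimple `W^{K(𝔫)} ≅ π_∞ ⊗ π_f^{K(𝔫)}`,
`r` a `(𝔤, K_∞)`-projection onto it composed with `e_{K(𝔫)}`).  Then for every cocycle
`z ∈ C^{q+1}(𝔤, K_∞; V ⊗ (E_λ ⊗ ε_S))` which is not a coboundary, `(j ⊗ 1)_* z` is a level-fixed cocycle of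
`gkComplexLS π S λ` which is not a coboundary at all (the cochain map `(r ⊗ 1)_*` is a left inverse of
`(j ⊗ 1)_*`), in particular not the coboundary of a level-fixed cochain.
[cite: BorelWallach2000, I §5.1] [cite: Clozel1990, §3.5 (p. 123)] -/
theorem exists_levelFixed_of_retraction
    (hjK : ∀ k : (AutomorphyDatum.gl n K hcpt).arch.maximalCompact, j ∘ₗ ρK k = π.kRepW k ∘ₗ j)
    (hj𝔤 : ∀ X : (AutomorphyDatum.gl n K hcpt).arch.lie, j ∘ₗ ρ𝔤 X = π.lieRepW X ∘ₗ j)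
    (hje : ∀ v : V, levelProj π h𝔫 (j v) = j v)
    (hrK : ∀ k : (AutomorphyDatum.gl n K hcpt).arch.maximalCompact, r ∘ₗ π.kRepW k = ρK k ∘ₗ r)
    (hr𝔤 : ∀ X : (AutomorphyDatum.gl n K hcpt).arch.lie, r ∘ₗ π.lieRepW X = ρ𝔤 X ∘ₗ r)
    (hrj : r ∘ₗ j = LinearMap.id) {q : ℕ}
    {z : Literature.Algebra.Lie.ChevalleyEilenberg.Cochain ℝ (AutomorphyDatum.gl n K hcpt).arch.lie (CarrierV ρ𝔤 lam) (q + 1)}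
    (hz : z ∈ (gkComplexV ρK ρ𝔤 had S lam).cocycles (q + 1))
    (hz' : z ∉ (gkComplexV ρK ρ𝔤 had S lam).coboundaries (q + 1)) :
    ∃ η : Cochain π lam (q + 1), η ∈ (gkComplexLS π S lam).cocycles (q + 1) ∧ IsLevelFixed π lam 𝔫 η ∧
      η ∉ (gkComplexLS π S lam).coboundaries (q + 1) ∧
      ∀ β ∈ (gkComplexLS π S lam).carrier q, IsLevelFixed π lam 𝔫 β →
        d ℝ (AutomorphyDatum.gl n K hcpt).arch.lie (Carrier π lam) q β ≠ η := by
  -- the cochain maps `(j ⊗ 1)_*` and `(r ⊗ 1)_*`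
  have hF := isCochainMapTo_hom (AutomorphyDatum.gl n K hcpt).arch (ρK.tprod (σSK hcpt S lam))
    (GKTensor.lie (AutomorphyDatum.gl n K hcpt).arch ρ𝔤 (σ𝔤S hcpt lam)) (π.kRepW.tprod (σSK hcpt S lam))
    (GKTensor.lie (AutomorphyDatum.gl n K hcpt).arch π.lieRepW (σ𝔤S hcpt lam))
    (GKTensor.ad_compat (AutomorphyDatum.gl n K hcpt).arch ρK ρ𝔤 (σSK hcpt S lam) (σ𝔤S hcpt lam) had
      (σS_ad_compat S lam))
    (GKTensor.ad_compat (AutomorphyDatum.gl n K hcpt).arch π.kRepW π.lieRepW (σSK hcpt S lam) (σ𝔤S hcpt lam)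
      π.kRepW_lieRepW_ad_compat (σS_ad_compat S lam))
    (j.rTensor (ResGLnCohomology.CoeffModule ℂ n K lam)) (rTensor_comp_lie_of_comm lam j hj𝔤)
    (rTensor_comp_tprod_of_comm S lam j hjK)
  have hG := isCochainMapTo_hom (AutomorphyDatum.gl n K hcpt).arch (π.kRepW.tprod (σSK hcpt S lam))
    (GKTensor.lie (AutomorphyDatum.gl n K hcpt).arch π.lieRepW (σ𝔤S hcpt lam)) (ρK.tprod (σSK hcpt S lam))
    (GKTensor.lie (AutomorphyDatum.gl n K hcpt).arch ρ𝔤 (σ𝔤S hcpt lam))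
    (GKTensor.ad_compat (AutomorphyDatum.gl n K hcpt).arch π.kRepW π.lieRepW (σSK hcpt S lam) (σ𝔤S hcpt lam)
      π.kRepW_lieRepW_ad_compat (σS_ad_compat S lam))
    (GKTensor.ad_compat (AutomorphyDatum.gl n K hcpt).arch ρK ρ𝔤 (σSK hcpt S lam) (σ𝔤S hcpt lam) had
      (σS_ad_compat S lam))
    (r.rTensor (ResGLnCohomology.CoeffModule ℂ n K lam)) (rTensor_comp_lie_of_comm lam r hr𝔤)
    (rTensor_comp_tprod_of_comm S lam r hrK)
  -- `(r ⊗ 1)_* ∘ (j ⊗ 1)_* = id`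
  have hGF : ∀ (q : ℕ) (f : Literature.Algebra.Lie.ChevalleyEilenberg.Cochain ℝ
      (AutomorphyDatum.gl n K hcpt).arch.lie (CarrierV ρ𝔤 lam) q),
      map (AutomorphyDatum.gl n K hcpt).arch.lie
        (GKCarrier.hom (AutomorphyDatum.gl n K hcpt).arch
          (GKTensor.lie (AutomorphyDatum.gl n K hcpt).arch π.lieRepW (σ𝔤S hcpt lam))
          (GKTensor.lie (AutomorphyDatum.gl n K hcpt).arch ρ𝔤 (σ𝔤S hcpt lam))
          (r.rTensor (ResGLnCohomology.CoeffModule ℂ n K lam)) (rTensor_comp_lie_of_comm lam r hr𝔤)) q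
        (map (AutomorphyDatum.gl n K hcpt).arch.lie
          (GKCarrier.hom (AutomorphyDatum.gl n K hcpt).arch
            (GKTensor.lie (AutomorphyDatum.gl n K hcpt).arch ρ𝔤 (σ𝔤S hcpt lam))
            (GKTensor.lie (AutomorphyDatum.gl n K hcpt).arch π.lieRepW (σ𝔤S hcpt lam))
            (j.rTensor (ResGLnCohomology.CoeffModule ℂ n K lam)) (rTensor_comp_lie_of_comm lam j hj𝔤)) q f) = f := by
    intro q f
    refine AlternatingMap.ext fun v => ?_
    change r.rTensor (ResGLnCohomology.CoeffModule ℂ n K lam)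
        (j.rTensor (ResGLnCohomology.CoeffModule ℂ n K lam)
          (@id (V ⊗[ℂ] ResGLnCohomology.CoeffModule ℂ n K lam) (f v))) =
      @id (V ⊗[ℂ] ResGLnCohomology.CoeffModule ℂ n K lam) (f v)
    rw [← LinearMap.comp_apply, ← LinearMap.rTensor_comp, hrj, LinearMap.rTensor_id, LinearMap.id_apply]
  have hη : map (AutomorphyDatum.gl n K hcpt).arch.lie
      (GKCarrier.hom (AutomorphyDatum.gl n K hcpt).arch
        (GKTensor.lie (AutomorphyDatum.gl n K hcpt).arch ρ𝔤 (σ𝔤S hcpt lam))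
        (GKTensor.lie (AutomorphyDatum.gl n K hcpt).arch π.lieRepW (σ𝔤S hcpt lam))
        (j.rTensor (ResGLnCohomology.CoeffModule ℂ n K lam)) (rTensor_comp_lie_of_comm lam j hj𝔤)) (q + 1) z ∉
      (gkComplexLS π S lam).coboundaries (q + 1) :=
    hG.not_mem_coboundaries_of_leftInverse _ hGF hz'
  refine ⟨map (AutomorphyDatum.gl n K hcpt).arch.lie
      (GKCarrier.hom (AutomorphyDatum.gl n K hcpt).arch
        (GKTensor.lie (AutomorphyDatum.gl n K hcpt).arch ρ𝔤 (σ𝔤S hcpt lam))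
        (GKTensor.lie (AutomorphyDatum.gl n K hcpt).arch π.lieRepW (σ𝔤S hcpt lam))
        (j.rTensor (ResGLnCohomology.CoeffModule ℂ n K lam)) (rTensor_comp_lie_of_comm lam j hj𝔤)) (q + 1) z,
    ?_, ?_, hη, ?_⟩
  · have h := hF.mapsTo_cocycles (q + 1) z hz
    exact h
  · -- the values `(j ⊗ 1)(z w)` are `K(𝔫)`-fixed
    intro w u hu
    change (π.finiteRepW _).rTensor (ResGLnCohomology.CoeffModule ℂ n K lam)
        (j.rTensor (ResGLnCohomology.CoeffModule ℂ n K lam)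
          (@id (V ⊗[ℂ] ResGLnCohomology.CoeffModule ℂ n K lam) (z w))) =
      j.rTensor (ResGLnCohomology.CoeffModule ℂ n K lam) (@id (V ⊗[ℂ] ResGLnCohomology.CoeffModule ℂ n K lam) (z w))
    rw [← LinearMap.comp_apply, ← LinearMap.rTensor_comp,
      finiteRepW_comp_eq_of_levelProj π h𝔫 hje (ofFinite_mem_levelFin hu)]
  · intro β hβ _ hd
    exact hη (((gkComplexLS π S lam).mem_coboundaries_succ_iff q _).2 ⟨β, hβ, hd⟩)

end Retraction

open Literature.NumberTheory.DiophantineGeometry Literature.Barriers.Langlands in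
/-- **The apex fact follows from a non-zero class of `H^{q+2}(𝔤, K_∞; V ⊗ (E_λ ⊗ ε_S))` for a
`(𝔤, K_∞)`-RETRACT `V` of `W` inside `e_{K(𝔫)} W`** (intertwiners `j : V → W`, `r : W → V` with `r ∘ j = id`,
`j(V) ⊆ e_{K(𝔫)} W`) — the form in which Clozel's Lemme 3.14 is used: `V` one copy of the archimedean component
`π_∞` inside `W^{K(𝔫)} ≅ π_∞ ⊗ π_f^{K(𝔫)}`, `H^m(𝔤, K_∞; π_∞ ⊗ E_λ ⊗ ε_S) ≠ 0` for some `m ≥ 2`.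
[cite: Clozel1990, Lemme 3.14 (p. 114) and §3.5 (pp. 120–123)] [cite: BorelWallach2000, I §5.1] -/
theorem Clozel1990_exists_basic_levelFixed_cocycle_of_retractClass
    (H : ∀ (n : ℕ) (K : Type) [Field K] [NumberField K] (hcpt : isCompact_glFiniteIntegralLevel n K)
      (𝔫 : Ideal (𝓞 K)) (lam : (K →+* ℂ) → Fin n → ℤ), 2 ≤ n → ∀ h𝔫 : 𝔫 ≠ 0,
      (∀ τ, Weight.IsDominant (lam τ)) →
      ∀ π : CuspidalAutomorphicRepData n K hcpt, π.1.W' = ⊥ →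
        (∃ μ : ℂ, ∀ c ∈ π.1.W, lieDeriv (AutomorphyDatum.gl n K hcpt).ofArch
          (⟨1, trivial⟩ : (AutomorphyDatum.gl n K hcpt).arch.lie) c = μ • c) →
        (∃ T : InfinityType K n, π.1.HasInfinityType T ∧
          ∀ τ : K →+* ℂ, (T τ).map ArchWeight.a =
            (cohomologicalInfinityType n K (Weight.dual (lam τ)) τ).map ArchWeight.a) →
        (∃ φ ∈ π.1.W, φ ≠ 0 ∧
          ∀ u ∈ principalCongruenceLevel n K 𝔫, rightTranslation (AdelicGroupData.gl n K) u φ = φ) →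
        ∃ (S : Finset {w : InfinitePlace K // w.IsReal}) (V : Type) (_ : AddCommGroup V) (_ : Module ℂ V)
          (ρK : Representation ℂ (AutomorphyDatum.gl n K hcpt).arch.maximalCompact V)
          (ρ𝔤 : (AutomorphyDatum.gl n K hcpt).arch.lie →ₗ⁅ℝ⁆ Module.End ℂ V)
          (had : ∀ (k : (AutomorphyDatum.gl n K hcpt).arch.maximalCompact) (X : (AutomorphyDatum.gl n K hcpt).arch.lie),
            ρK k ∘ₗ ρ𝔤 X ∘ₗ ρK k⁻¹ =
              ρ𝔤 ((AutomorphyDatum.gl n K hcpt).arch.Ad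
                (Subgroup.inclusion (AutomorphyDatum.gl n K hcpt).arch.maximalCompact_le_carrier k) X))
          (j : V →ₗ[ℂ] π.1.W) (r : π.1.W →ₗ[ℂ] V),
          (∀ k, j ∘ₗ ρK k = π.1.kRepW k ∘ₗ j) ∧ (∀ X, j ∘ₗ ρ𝔤 X = π.1.lieRepW X ∘ₗ j) ∧
            (∀ v, levelProj π.1 h𝔫 (j v) = j v) ∧
            (∀ k, r ∘ₗ π.1.kRepW k = ρK k ∘ₗ r) ∧ (∀ X, r ∘ₗ π.1.lieRepW X = ρ𝔤 X ∘ₗ r) ∧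
            r ∘ₗ j = LinearMap.id ∧
            ∃ (q : ℕ) (z : Literature.Algebra.Lie.ChevalleyEilenberg.Cochain ℝ (AutomorphyDatum.gl n K hcpt).arch.lie
                (CarrierV ρ𝔤 lam) (q + 2)),
              z ∈ (gkComplexV ρK ρ𝔤 had S lam).cocycles (q + 2) ∧
                z ∉ (gkComplexV ρK ρ𝔤 had S lam).coboundaries (q + 2)) :
    Clozel1990_exists_basic_levelFixed_cocycle := by
  refine Clozel1990_exists_basic_levelFixed_cocycle_of_cohomology_two ?_
  intro n K _ _ hcpt 𝔫 lam hn h𝔫 hdom π hW' hμ hT hφ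
  have H' := H n K hcpt 𝔫 lam hn h𝔫 hdom π hW' hμ hT hφ
  obtain ⟨S, V, _, _, ρK, ρ𝔤, had, j, r, hjK, hj𝔤, hje, hrK, hr𝔤, hrj, q, z, hz, hz'⟩ := H'
  have h := exists_levelFixed_of_retraction (π := π.1) (had := had) (S := S) (lam := lam) h𝔫 hjK hj𝔤 hje hrK hr𝔤
    hrj hz hz'
  obtain ⟨η, h1, h2, -, h4⟩ := h
  refine ⟨S, q, η, ?_, h2, ?_⟩
  · exact h1
  · exact h4

open Literature.NumberTheory.DiophantineGeometry Literature.Barriers.Langlands in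
/-- **The apex fact follows from a cocycle of `C^{q+2}(𝔤, K_∞; W^{K(𝔫)} ⊗ (E_λ(ℂ) ⊗ ε_S))` which is not a
coboundary** — non-vanishing of `H^{q+2}(𝔤, K_∞; W^{K(𝔫)} ⊗ E_λ ⊗ ε_S)` for the `(𝔤, K_∞)`-module of
`K(𝔫)`-invariants, for some set `S` of real places and some `q`, for every `n ≥ 2`, `𝔫 ≠ 0`, dominant `λ` and
clean cohomological cuspidal `π` with a non-zero `K(𝔫)`-fixed form.  In print: `W^{K(𝔫)} ≅ π_∞ ⊗ π_f^{K(𝔫)}`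
and `H^m(𝔤, K_∞; π_∞ ⊗ E_λ ⊗ ε_S) ≠ 0` for `∑_v d_v ≤ m ≤ ∑_v d_v + dim(𝔷 ∩ 𝔭)` (so some `m ≥ 2`).
[cite: Clozel1990, Lemme 3.14 (p. 114) and §3.5 (pp. 120–123)] [cite: BorelWallach2000, I §5.1] -/
theorem Clozel1990_exists_basic_levelFixed_cocycle_of_invariantsClass
    (H : ∀ (n : ℕ) (K : Type) [Field K] [NumberField K] (hcpt : isCompact_glFiniteIntegralLevel n K)
      (𝔫 : Ideal (𝓞 K)) (lam : (K →+* ℂ) → Fin n → ℤ), 2 ≤ n → ∀ h𝔫 : 𝔫 ≠ 0,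
      (∀ τ, Weight.IsDominant (lam τ)) →
      ∀ π : CuspidalAutomorphicRepData n K hcpt, π.1.W' = ⊥ →
        (∃ μ : ℂ, ∀ c ∈ π.1.W, lieDeriv (AutomorphyDatum.gl n K hcpt).ofArch
          (⟨1, trivial⟩ : (AutomorphyDatum.gl n K hcpt).arch.lie) c = μ • c) →
        (∃ T : InfinityType K n, π.1.HasInfinityType T ∧
          ∀ τ : K →+* ℂ, (T τ).map ArchWeight.a =
            (cohomologicalInfinityType n K (Weight.dual (lam τ)) τ).map ArchWeight.a) →
        (∃ φ ∈ π.1.W, φ ≠ 0 ∧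
          ∀ u ∈ principalCongruenceLevel n K 𝔫, rightTranslation (AdelicGroupData.gl n K) u φ = φ) →
        ∃ (S : Finset {w : InfinitePlace K // w.IsReal}) (q : ℕ)
          (z : Literature.Algebra.Lie.ChevalleyEilenberg.Cochain ℝ (AutomorphyDatum.gl n K hcpt).arch.lie
            (CarrierV (invLie π.1 h𝔫) lam) (q + 2)),
          z ∈ (gkComplexV (invKRep π.1 h𝔫) (invLie π.1 h𝔫) (inv_ad_compat π.1 h𝔫) S lam).cocycles (q + 2) ∧
            z ∉ (gkComplexV (invKRep π.1 h𝔫) (invLie π.1 h𝔫) (inv_ad_compat π.1 h𝔫) S lam).coboundaries (q + 2)) :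
    Clozel1990_exists_basic_levelFixed_cocycle := by
  refine Clozel1990_exists_basic_levelFixed_cocycle_of_cohomology_two ?_
  intro n K _ _ hcpt 𝔫 lam hn h𝔫 hdom π hW' hμ hT hφ
  obtain ⟨S, q, z, hz, hz'⟩ := H n K hcpt 𝔫 lam hn h𝔫 hdom π hW' hμ hT hφ
  obtain ⟨η, h1, h2, h3⟩ :=
    exists_levelFixed_of_moduleHom (π := π.1) (had := inv_ad_compat π.1 h𝔫) (S := S) (lam := lam) h𝔫
      (subtype_comp_invKRep π.1 h𝔫) (subtype_comp_invLie π.1 h𝔫) (invW π.1 h𝔫).injective_subtype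
      (levelProj_coe_invW π.1 h𝔫) (mem_range_subtype_of_levelProj_eq π.1 h𝔫) hz hz'
  refine ⟨S, q, η, h1, h2, ?_⟩
  exact h3

open Literature.NumberTheory.DiophantineGeometry Literature.Barriers.Langlands in
/-- **The apex fact follows from `H^{q+2}(𝔤, K_∞; W^{K(𝔫)} ⊗ (E_λ(ℂ) ⊗ ε_S)) ≠ 0`** (a non-zero class of the
`(𝔤, K_∞)`-cohomology of the module of `K(𝔫)`-invariants with coefficients `E_λ ⊗ ε_S`, for some set `S` of real
places and some degree `q + 2 ≥ 2`), for every `n ≥ 2`, `𝔫 ≠ 0`, dominant `λ` and clean cohomological cuspidal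
`π` with a non-zero `K(𝔫)`-fixed form — the cohomological form of the hypothesis of
`Clozel1990_exists_basic_levelFixed_cocycle_of_invariantsClass`.
[cite: Clozel1990, Lemme 3.14 (p. 114) and §3.5 (pp. 120–123)] [cite: BorelWallach2000, I §5.1 (4)] -/
theorem Clozel1990_exists_basic_levelFixed_cocycle_of_gkCohomology_ne_zero
    (H : ∀ (n : ℕ) (K : Type) [Field K] [NumberField K] (hcpt : isCompact_glFiniteIntegralLevel n K)
      (𝔫 : Ideal (𝓞 K)) (lam : (K →+* ℂ) → Fin n → ℤ), 2 ≤ n → ∀ h𝔫 : 𝔫 ≠ 0,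
      (∀ τ, Weight.IsDominant (lam τ)) →
      ∀ π : CuspidalAutomorphicRepData n K hcpt, π.1.W' = ⊥ →
        (∃ μ : ℂ, ∀ c ∈ π.1.W, lieDeriv (AutomorphyDatum.gl n K hcpt).ofArch
          (⟨1, trivial⟩ : (AutomorphyDatum.gl n K hcpt).arch.lie) c = μ • c) →
        (∃ T : InfinityType K n, π.1.HasInfinityType T ∧
          ∀ τ : K →+* ℂ, (T τ).map ArchWeight.a =
            (cohomologicalInfinityType n K (Weight.dual (lam τ)) τ).map ArchWeight.a) →
        (∃ φ ∈ π.1.W, φ ≠ 0 ∧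
          ∀ u ∈ principalCongruenceLevel n K 𝔫, rightTranslation (AdelicGroupData.gl n K) u φ = φ) →
        ∃ (S : Finset {w : InfinitePlace K // w.IsReal}) (q : ℕ)
          (c : (gkComplexV (invKRep π.1 h𝔫) (invLie π.1 h𝔫) (inv_ad_compat π.1 h𝔫) S lam).Cohomology (q + 2)), c ≠ 0) :
    Clozel1990_exists_basic_levelFixed_cocycle := by
  refine Clozel1990_exists_basic_levelFixed_cocycle_of_invariantsClass ?_
  intro n K _ _ hcpt 𝔫 lam hn h𝔫 hdom π hW' hμ hT hφ
  -- (`have` first: destructuring the applied hypothesis in one `obtain` makes the elaborator unfold the towers)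
  have H' := H n K hcpt 𝔫 lam hn h𝔫 hdom π hW' hμ hT hφ
  obtain ⟨S, q, c, hc⟩ := H'
  have h2 := Subcomplex.exists_not_mem_coboundaries_of_ne_zero
    (gkComplexV (invKRep π.1 h𝔫) (invLie π.1 h𝔫) (inv_ad_compat π.1 h𝔫) S lam) (q + 2) c hc
  obtain ⟨z, hz, hz'⟩ := h2
  refine ⟨S, q, z, ?_, ?_⟩
  · exact hz
  · exact hz'

open Literature.NumberTheory.DiophantineGeometry Literature.Barriers.Langlands in
/-- **The apex fact follows from a non-zero class of `H^{q+2}(𝔤, K_∞; V ⊗ (E_λ ⊗ ε_S))` for a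
`(𝔤, K_∞)`-module `V` mapping isomorphically onto the `K(𝔫)`-invariants `e_{K(𝔫)} W`.**  Precisely: it
suffices that for every `n ≥ 2`, `𝔫 ≠ 0`, dominant `λ` and clean cohomological cuspidal `π` with a non-zero
`K(𝔫)`-fixed form there be a set `S` of real places, a complex vector space `V` with a representation `ρK` of
`K_∞` and a compatible action `ρ𝔤` of `𝔤`, an injective `ℂ`-linear `j : V → W` intertwining `(ρK, ρ𝔤)` with
`(r|_{K_∞}, Lie derivative)` whose image is `e_{K(𝔫)} W`, and a cocycle of some degree `q + 2` of
`C^•(𝔤, K_∞; V ⊗ (E_λ(ℂ) ⊗ ε_S))` which is not a coboundary.  In print: `V = W^{K(𝔫)} ≅ π_∞ ⊗ π_f^{K(𝔫)}`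
and `H^m(𝔤, K_∞; π_∞ ⊗ E_λ ⊗ ε_S) ≠ 0` for `∑_v d_v ≤ m ≤ ∑_v d_v + dim(𝔷 ∩ 𝔭)` (so some `m ≥ 2`).
[cite: Clozel1990, Lemme 3.14 (p. 114) and §3.5 (pp. 120–123)] [cite: BorelWallach2000, I §5.1] -/
theorem Clozel1990_exists_basic_levelFixed_cocycle_of_moduleClass
    (H : ∀ (n : ℕ) (K : Type) [Field K] [NumberField K] (hcpt : isCompact_glFiniteIntegralLevel n K)
      (𝔫 : Ideal (𝓞 K)) (lam : (K →+* ℂ) → Fin n → ℤ), 2 ≤ n → ∀ h𝔫 : 𝔫 ≠ 0,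
      (∀ τ, Weight.IsDominant (lam τ)) →
      ∀ π : CuspidalAutomorphicRepData n K hcpt, π.1.W' = ⊥ →
        (∃ μ : ℂ, ∀ c ∈ π.1.W, lieDeriv (AutomorphyDatum.gl n K hcpt).ofArch
          (⟨1, trivial⟩ : (AutomorphyDatum.gl n K hcpt).arch.lie) c = μ • c) →
        (∃ T : InfinityType K n, π.1.HasInfinityType T ∧
          ∀ τ : K →+* ℂ, (T τ).map ArchWeight.a =
            (cohomologicalInfinityType n K (Weight.dual (lam τ)) τ).map ArchWeight.a) →
        (∃ φ ∈ π.1.W, φ ≠ 0 ∧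
          ∀ u ∈ principalCongruenceLevel n K 𝔫, rightTranslation (AdelicGroupData.gl n K) u φ = φ) →
        ∃ (S : Finset {w : InfinitePlace K // w.IsReal}) (V : Type) (_ : AddCommGroup V) (_ : Module ℂ V)
          (ρK : Representation ℂ (AutomorphyDatum.gl n K hcpt).arch.maximalCompact V)
          (ρ𝔤 : (AutomorphyDatum.gl n K hcpt).arch.lie →ₗ⁅ℝ⁆ Module.End ℂ V)
          (had : ∀ (k : (AutomorphyDatum.gl n K hcpt).arch.maximalCompact) (X : (AutomorphyDatum.gl n K hcpt).arch.lie),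
            ρK k ∘ₗ ρ𝔤 X ∘ₗ ρK k⁻¹ =
              ρ𝔤 ((AutomorphyDatum.gl n K hcpt).arch.Ad
                (Subgroup.inclusion (AutomorphyDatum.gl n K hcpt).arch.maximalCompact_le_carrier k) X))
          (j : V →ₗ[ℂ] π.1.W),
          (∀ k, j ∘ₗ ρK k = π.1.kRepW k ∘ₗ j) ∧ (∀ X, j ∘ₗ ρ𝔤 X = π.1.lieRepW X ∘ₗ j) ∧
            Function.Injective j ∧ (∀ v, levelProj π.1 h𝔫 (j v) = j v) ∧
            (∀ w : π.1.W, levelProj π.1 h𝔫 w = w → w ∈ LinearMap.range j) ∧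
            ∃ (q : ℕ) (z : Literature.Algebra.Lie.ChevalleyEilenberg.Cochain ℝ (AutomorphyDatum.gl n K hcpt).arch.lie
                (CarrierV ρ𝔤 lam) (q + 2)),
              z ∈ (gkComplexV ρK ρ𝔤 had S lam).cocycles (q + 2) ∧
                z ∉ (gkComplexV ρK ρ𝔤 had S lam).coboundaries (q + 2)) :
    Clozel1990_exists_basic_levelFixed_cocycle := by
  refine Clozel1990_exists_basic_levelFixed_cocycle_of_cohomology_two ?_
  intro n K _ _ hcpt 𝔫 lam hn h𝔫 hdom π hW' hμ hT hφ
  obtain ⟨S, V, _, _, ρK, ρ𝔤, had, j, hjK, hj𝔤, hj, hje, hej, q, z, hz, hz'⟩ :=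
    H n K hcpt 𝔫 lam hn h𝔫 hdom π hW' hμ hT hφ
  obtain ⟨η, h1, h2, h3⟩ :=
    exists_levelFixed_of_moduleHom (π := π.1) (had := had) (S := S) (lam := lam) h𝔫 hjK hj𝔤 hj hje hej hz hz'
  -- (componentwise: a one-shot anonymous constructor makes the elaborator unfold the abbrev towers)
  refine ⟨S, q, η, h1, h2, ?_⟩
  exact h3

end ConeDictionary

end Literature.NumberTheory.Automorphic
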